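import Mathlib
import HarnessLib
import Summits.HubbardSuperconductivity.HubbardSuperconductivity.Theorems.ComplexGFFStiffnessHypACumulantTiltMoments

/-!
# Crux `HypACumulant`, line `gnv` — the LINEAR tilt `t ↦ 𝒦ˡ_{g,t} = (1 + tQ_u)(1 + 𝒦_g) − 1`:
# the second cumulant is the `t`-derivative at `0` of `|Λ| · onePoint n 𝒦ˡ_{g,t} Q_u`

Route `route-HubbardSuperconductivity-ComplexGFFStiffness`, crux item stmt-HubbardSuperconductivity-19154
(`HypACumulant`), registered stub `stub_cumulantGivenZ : CumulantGivenZ`.  Part 2/3 of the reduction of that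
stub to `…Theorems.ComplexGFF.OnePointLipschitz` (the `N`-uniform Lipschitz continuity of one-point functions
in the perturbation, shared with the sibling crux `HypALocalTwoPoint`).  The AFFINE path
`t ↦ 𝒦ˡ_{g,t} = 𝒦_g + t·Q_u·(1 + 𝒦_g)` through the model's perturbation `𝒦_g = pertK g` in the direction
`Q_u·(1+𝒦_g)` (`linTiltK`) has `e^{−S_0} ∏_x (1 + 𝒦ˡ_{g,t}(∇φ(x))) = w_{g,0} · ∏_y (1 + tQ_u(∇φ(y)))`
(`exp_neg_S_mul_prod_linTiltK`), is `ι`-symmetric for real `t` (`linTiltK_neg`), and `𝒦ˡ_{g,t} − 𝒦_g` is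
LINEAR in `t` (`linTiltK_sub`) — so its weighted `C^{r₀}` distance to `𝒦_g` is trivially `O(|t|)`, which is
what the Lipschitz statement consumes (part 3/3).  Fixed-volume calculus (dominated differentiation, with
the domination `|∏(1 + tq_y)| ≤ e^{|t|Σ|q_y|}`, `Σ_y|Q_u(∇φ(y))| ≤ 6‖u‖S_0`):

* `hasDerivAt_linTiltMoment_zero` — `Mˡ_k(t) = ∫ w_{g,0} Y_u^k ∏_y(1 + tQ_u(∇φ(y)))` has `(Mˡ_k)'(0) = M_{k+1}(0)`;
* `onePoint_linTiltK` — `|Λ| · onePoint n 𝒦ˡ_{g,t} Q_u = Mˡ₁(t)/Mˡ₀(t)`;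
* **`hasDerivAt_card_mul_onePoint_linTiltK`** — if `Z_n(g,0) ≠ 0`, `t ↦ |Λ| · onePoint n 𝒦ˡ_{g,t} Q_u` has
  derivative `⟨Y_u²⟩_g − ⟨Y_u⟩_g²` at `t = 0` ([ABKM19] Thm 2.2 with `ℓ = 2`: the second cumulant is the
  derivative of an `ℓ = 1` quantity along a path in the space of perturbations).

Nothing uniform in the volume is claimed; nothing here bears on the Hubbard model beyond the crux's
bookkeeping.  All proved, no `sorry`.

## References
* S. Adams, S. Buchholz, R. Kotecký, S. Müller, arXiv:1910.13564, Sec. 2.1, Theorem 2.2, (4.4)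
  [AdamsBuchholzKoteckyMuller2019].
-/

noncomputable section

-- `Summit.<Summit>.<Problem>`: single-conjunct summit, the duplicate component is mandated (D-0017).
set_option linter.dupNamespace false

namespace Summit.HubbardSuperconductivity.HubbardSuperconductivity.Theorems.ComplexGFF

open scoped BigOperators ComplexConjugate
open MeasureTheory
open Literature.MathematicalPhysics.StatisticalMechanics.ComplexGradientGFF4 (Z ev Y D S X w)

variable {n : ℕ}

/-! ### The LINEAR tilt `𝒦ˡ_{g,t} = (1 + tQ_u)(1 + 𝒦_g) − 1` -/

/-- The linearly tilted single-site perturbation `𝒦ˡ_{g,t}(z) = 𝒦_g(z) + t·Q_u(z)·(1 + 𝒦_g(z))`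
(`= (1 + tQ_u(z))(1 + 𝒦_g(z)) − 1`): an affine path in the space of perturbations through `𝒦_g` in the
direction `Q_u·(1+𝒦_g)`, along which one-point functions of `Q_u` have `t`-derivative the second cumulant. -/
def linTiltK (g : ℝ) (u : Fin 4 → ℝ) (t : ℝ) (z : Fin 4 → ℝ) : ℂ :=
  pertK g z + ((t * tiltQ u z : ℝ) : ℂ) * (1 + pertK g z)

/-- The tilt product `P_t(φ) = ∏_y (1 + t·Q_u(∇φ(y)))`. -/
def tiltProd [NeZero n] (u : Fin 4 → ℝ) (t : ℝ) (φ : (Fin 4 → ZMod n) → ℝ) : ℝ :=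
  ∏ y : Fin 4 → ZMod n, (1 + t * tiltQ u (fun i => D φ i y))

/-- The moments along the linear tilt: `Mˡ_k(t) = ∫ w_{g,0}(φ) · Y_u(φ)^k · P_t(φ) dφ`. -/
def linTiltMoment (n : ℕ) [NeZero n] (g : ℝ) (u : Fin 4 → ℝ) (k : ℕ) (t : ℝ) : ℂ :=
  ∫ φ : (Fin 4 → ZMod n) → ℝ, w g 0 φ * (((Y u φ : ℝ) : ℂ) ^ k * ((tiltProd u t φ : ℝ) : ℂ))

/-- `1 + 𝒦ˡ_{g,t}(z) = (1 + tQ_u(z))·(1 + 𝒦_g(z))`. -/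
theorem one_add_linTiltK (g : ℝ) (u : Fin 4 → ℝ) (t : ℝ) (z : Fin 4 → ℝ) :
    1 + linTiltK g u t z = (1 + ((t * tiltQ u z : ℝ) : ℂ)) * (1 + pertK g z) := by
  unfold linTiltK
  ring

/-- `𝒦ˡ_{g,0} = 𝒦_g`. -/
theorem linTiltK_zero (g : ℝ) (u : Fin 4 → ℝ) : linTiltK g u 0 = pertK g := by
  funext z
  unfold linTiltK
  simp

/-- `𝒦ˡ_{g,t} − 𝒦_g = t · Q_u · (1 + 𝒦_g)`. -/
theorem linTiltK_sub (g : ℝ) (u : Fin 4 → ℝ) (t : ℝ) (z : Fin 4 → ℝ) :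
    linTiltK g u t z - pertK g z = (t : ℂ) * (((tiltQ u z : ℝ) : ℂ) * (1 + pertK g z)) := by
  unfold linTiltK
  push_cast
  ring

/-- `ι`-symmetry of the linear tilt (real `t`): `𝒦ˡ_{g,t}(−z) = conj 𝒦ˡ_{g,t}(z)`. -/
theorem linTiltK_neg (g : ℝ) (u : Fin 4 → ℝ) (t : ℝ) (z : Fin 4 → ℝ) :
    linTiltK g u t (-z) = conj (linTiltK g u t z) := by
  unfold linTiltK
  rw [pertK_neg, tiltQ_neg, map_add, map_mul, map_add, map_one, Complex.conj_ofReal]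

/-- `P_0 = 1`. -/
theorem tiltProd_zero [NeZero n] (u : Fin 4 → ℝ) (φ : (Fin 4 → ZMod n) → ℝ) : tiltProd u 0 φ = 1 := by
  unfold tiltProd
  simp

/-- **The linearly tilted weight factorises:** `e^{−S_0} ∏_x (1 + 𝒦ˡ_{g,t}(∇φ(x))) = w_{g,0} · P_t`. -/
theorem exp_neg_S_mul_prod_linTiltK [NeZero n] (g : ℝ) (u : Fin 4 → ℝ) (t : ℝ) (φ : (Fin 4 → ZMod n) → ℝ) :
    Complex.exp (-((S 0 φ : ℝ) : ℂ)) * ∏ x : Fin 4 → ZMod n, (1 + linTiltK g u t (fun i => D φ i x))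
      = w g 0 φ * ((tiltProd u t φ : ℝ) : ℂ) := by
  simp only [one_add_linTiltK]
  rw [Finset.prod_mul_distrib, w_zero_eq_exp_mul_prod]
  unfold tiltProd
  push_cast
  ring

/-- `pertZ n 𝒦ˡ_{g,t} = Mˡ₀(t)`. -/
theorem pertZ_linTiltK [NeZero n] (g : ℝ) (u : Fin 4 → ℝ) (t : ℝ) :
    pertZ n (linTiltK g u t) = linTiltMoment n g u 0 t := by
  unfold pertZ linTiltMoment
  refine integral_congr_ae (Filter.Eventually.of_forall (fun φ => ?_))
  simp only [pow_zero, one_mul]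
  exact exp_neg_S_mul_prod_linTiltK g u t φ

/-- at `t = 0` the linear and the exponential tilt moments agree: `Mˡ_k(0) = M_k(0)`. -/
theorem linTiltMoment_at_zero [NeZero n] (g : ℝ) (u : Fin 4 → ℝ) (k : ℕ) :
    linTiltMoment n g u k 0 = tiltMoment n g u k 0 := by
  unfold linTiltMoment tiltMoment
  refine integral_congr_ae (Filter.Eventually.of_forall (fun φ => ?_))
  simp only [tiltProd_zero, Complex.ofReal_one, mul_one, Complex.ofReal_zero, zero_mul, Complex.exp_zero]

/-- `Mˡ₁(t) = ∫ (Σ_x Q_u(∇φ(x))) · e^{−S_0} ∏_y (1 + 𝒦ˡ_{g,t}(∇φ(y)))`. -/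
theorem linTiltMoment_one_eq [NeZero n] (g : ℝ) (u : Fin 4 → ℝ) (t : ℝ) :
    linTiltMoment n g u 1 t =
      ∫ φ : (Fin 4 → ZMod n) → ℝ,
        (∑ x : Fin 4 → ZMod n, ((tiltQ u (fun i => D φ i x) : ℝ) : ℂ)) *
          (Complex.exp (-((S 0 φ : ℝ) : ℂ)) * ∏ x : Fin 4 → ZMod n, (1 + linTiltK g u t (fun i => D φ i x))) := by
  unfold linTiltMoment
  refine integral_congr_ae (Filter.Eventually.of_forall (fun φ => ?_))
  beta_reduce
  rw [exp_neg_S_mul_prod_linTiltK, pow_one, Y_eq_sum_tiltQ]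
  push_cast
  ring

/-- **One-point functions along the linear tilt:** `|Λ| · onePoint n 𝒦ˡ_{g,t} Q_u = Mˡ₁(t)/Mˡ₀(t)`. -/
theorem onePoint_linTiltK [NeZero n] (g : ℝ) (u : Fin 4 → ℝ) (t : ℝ) :
    (Fintype.card (Fin 4 → ZMod n) : ℂ) * onePoint n (linTiltK g u t) (fun z => ((tiltQ u z : ℝ) : ℂ))
      = linTiltMoment n g u 1 t / linTiltMoment n g u 0 t := by
  unfold onePoint
  beta_reduce
  rw [← linTiltMoment_one_eq, pertZ_linTiltK]
  have hcard : (Fintype.card (Fin 4 → ZMod n) : ℂ) ≠ 0 := by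
    exact_mod_cast Fintype.card_ne_zero
  rw [← mul_div_assoc, mul_div_mul_left _ _ hcard]

/-! ### Domination along the linear tilt -/

/-- `Σ_y |Q_u(∇φ(y))| ≤ 6‖u‖ S_0(φ)`. -/
theorem sum_abs_tiltQ_le [NeZero n] (u : Fin 4 → ℝ) (φ : (Fin 4 → ZMod n) → ℝ) :
    ∑ y : Fin 4 → ZMod n, |tiltQ u (fun i => D φ i y)| ≤ 6 * ‖u‖ * S 0 φ := by
  calc ∑ y : Fin 4 → ZMod n, |tiltQ u (fun i => D φ i y)|
      ≤ ∑ y : Fin 4 → ZMod n, 3 * ‖u‖ * ∑ i : Fin 4, (D φ i y) ^ 2 :=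
        Finset.sum_le_sum (fun y _ => abs_tiltQ_le u _)
    _ = 3 * ‖u‖ * ∑ y : Fin 4 → ZMod n, ∑ i : Fin 4, (D φ i y) ^ 2 := by rw [Finset.mul_sum]
    _ ≤ 3 * ‖u‖ * (2 * S 0 φ) :=
        mul_le_mul_of_nonneg_left (sum_sq_D_le_two_S φ) (by positivity)
    _ = 6 * ‖u‖ * S 0 φ := by ring

/-- a sub-product of `∏ (1 + t q_y)` is bounded by `exp(|t| Σ_y |q_y|)`. -/
theorem abs_prod_erase_le [NeZero n] (u : Fin 4 → ℝ) (t : ℝ) (φ : (Fin 4 → ZMod n) → ℝ)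
    (s : Finset (Fin 4 → ZMod n)) :
    |∏ y ∈ s, (1 + t * tiltQ u (fun i => D φ i y))|
      ≤ Real.exp (|t| * ∑ y : Fin 4 → ZMod n, |tiltQ u (fun i => D φ i y)|) := by
  rw [Finset.abs_prod]
  calc ∏ y ∈ s, |1 + t * tiltQ u (fun i => D φ i y)|
      ≤ ∏ y ∈ s, Real.exp (|t| * |tiltQ u (fun i => D φ i y)|) := by
        refine Finset.prod_le_prod (fun y _ => abs_nonneg _) (fun y _ => ?_)
        calc |1 + t * tiltQ u (fun i => D φ i y)| ≤ |(1 : ℝ)| + |t * tiltQ u (fun i => D φ i y)| := abs_add_le _ _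
          _ = |t| * |tiltQ u (fun i => D φ i y)| + 1 := by rw [abs_one, abs_mul, add_comm]
          _ ≤ Real.exp (|t| * |tiltQ u (fun i => D φ i y)|) := Real.add_one_le_exp _
    _ = Real.exp (∑ y ∈ s, |t| * |tiltQ u (fun i => D φ i y)|) := by rw [Real.exp_sum]
    _ ≤ Real.exp (|t| * ∑ y : Fin 4 → ZMod n, |tiltQ u (fun i => D φ i y)|) := by
        apply Real.exp_le_exp.mpr
        rw [← Finset.mul_sum]
        refine mul_le_mul_of_nonneg_left ?_ (abs_nonneg t)
        exact Finset.sum_le_sum_of_subset_of_nonneg (Finset.subset_univ s) (fun y _ _ => abs_nonneg _)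

/-- `|P_t(φ)| ≤ e^{S_0(φ)/8}` for `|t| ≤ 1/(48(‖u‖+1))`. -/
theorem abs_tiltProd_le [NeZero n] (u : Fin 4 → ℝ) (φ : (Fin 4 → ZMod n) → ℝ) {t : ℝ}
    (ht : |t| ≤ 1 / (48 * (‖u‖ + 1))) : |tiltProd u t φ| ≤ Real.exp (S 0 φ / 8) := by
  unfold tiltProd
  refine le_trans (abs_prod_erase_le u t φ Finset.univ) (Real.exp_le_exp.mpr ?_)
  have hS := S_zero_nonneg φ
  have hu0 : 0 ≤ ‖u‖ := norm_nonneg u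
  calc |t| * ∑ y : Fin 4 → ZMod n, |tiltQ u (fun i => D φ i y)|
      ≤ 1 / (48 * (‖u‖ + 1)) * (6 * ‖u‖ * S 0 φ) :=
        mul_le_mul ht (sum_abs_tiltQ_le u φ) (Finset.sum_nonneg (fun _ _ => abs_nonneg _)) (by positivity)
    _ ≤ S 0 φ / 8 := by
        rw [div_mul_eq_mul_div, one_mul, div_le_iff₀ (by positivity)]
        nlinarith [mul_nonneg hu0 hS]

/-- `t ↦ P_t(φ)` is differentiable: `P_t' = Σ_y q_y ∏_{y' ≠ y} (1 + t q_{y'})`. -/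
theorem hasDerivAt_tiltProd [NeZero n] (u : Fin 4 → ℝ) (φ : (Fin 4 → ZMod n) → ℝ) (t : ℝ) :
    HasDerivAt (fun s : ℝ => tiltProd u s φ)
      (∑ y : Fin 4 → ZMod n, (∏ y' ∈ Finset.univ.erase y, (1 + t * tiltQ u (fun i => D φ i y')))
        * tiltQ u (fun i => D φ i y)) t := by
  unfold tiltProd
  have h : ∀ y ∈ (Finset.univ : Finset (Fin 4 → ZMod n)),
      HasDerivAt (fun s : ℝ => 1 + s * tiltQ u (fun i => D φ i y)) (tiltQ u (fun i => D φ i y)) t := by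
    intro y _
    have := ((hasDerivAt_id t).mul_const (tiltQ u (fun i => D φ i y))).const_add 1
    simpa using this
  have hp := HasDerivAt.finsetProd h
  rw [Finset.prod_fn] at hp
  simpa [smul_eq_mul] using hp

/-- the derivative of the tilt product is dominated: `|P_t'(φ)| ≤ 6‖u‖ S_0(φ) e^{S_0(φ)/8}` for
`|t| ≤ 1/(48(‖u‖+1))`. -/
theorem abs_tiltProd_deriv_le [NeZero n] (u : Fin 4 → ℝ) (φ : (Fin 4 → ZMod n) → ℝ) {t : ℝ}
    (ht : |t| ≤ 1 / (48 * (‖u‖ + 1))) :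
    |∑ y : Fin 4 → ZMod n, (∏ y' ∈ Finset.univ.erase y, (1 + t * tiltQ u (fun i => D φ i y')))
        * tiltQ u (fun i => D φ i y)| ≤ 6 * ‖u‖ * S 0 φ * Real.exp (S 0 φ / 8) := by
  have hS := S_zero_nonneg φ
  have hu0 : 0 ≤ ‖u‖ := norm_nonneg u
  have hexp : Real.exp (|t| * ∑ y : Fin 4 → ZMod n, |tiltQ u (fun i => D φ i y)|) ≤ Real.exp (S 0 φ / 8) := by
    apply Real.exp_le_exp.mpr
    calc |t| * ∑ y : Fin 4 → ZMod n, |tiltQ u (fun i => D φ i y)|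
        ≤ 1 / (48 * (‖u‖ + 1)) * (6 * ‖u‖ * S 0 φ) :=
          mul_le_mul ht (sum_abs_tiltQ_le u φ) (Finset.sum_nonneg (fun _ _ => abs_nonneg _)) (by positivity)
      _ ≤ S 0 φ / 8 := by
          rw [div_mul_eq_mul_div, one_mul, div_le_iff₀ (by positivity)]
          nlinarith [mul_nonneg hu0 hS]
  refine le_trans (Finset.abs_sum_le_sum_abs _ _) ?_
  calc ∑ y : Fin 4 → ZMod n, |(∏ y' ∈ Finset.univ.erase y, (1 + t * tiltQ u (fun i => D φ i y')))
          * tiltQ u (fun i => D φ i y)|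
      ≤ ∑ y : Fin 4 → ZMod n, Real.exp (S 0 φ / 8) * |tiltQ u (fun i => D φ i y)| := by
        refine Finset.sum_le_sum (fun y _ => ?_)
        rw [abs_mul]
        exact mul_le_mul_of_nonneg_right ((abs_prod_erase_le u t φ _).trans hexp) (abs_nonneg _)
    _ = Real.exp (S 0 φ / 8) * ∑ y : Fin 4 → ZMod n, |tiltQ u (fun i => D φ i y)| := by rw [Finset.mul_sum]
    _ ≤ Real.exp (S 0 φ / 8) * (6 * ‖u‖ * S 0 φ) :=
        mul_le_mul_of_nonneg_left (sum_abs_tiltQ_le u φ) (Real.exp_pos _).le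
    _ = 6 * ‖u‖ * S 0 φ * Real.exp (S 0 φ / 8) := by ring

/-- `s ≤ 8 e^{s/8}`. -/
theorem le_eight_mul_exp_eighth (s : ℝ) : s ≤ 8 * Real.exp (s / 8) := by
  have h := Real.add_one_le_exp (s / 8)
  linarith

/-- the linear-tilt integrands are continuous in the field. -/
theorem continuous_linTiltIntegrand [NeZero n] (g : ℝ) (u : Fin 4 → ℝ) (k : ℕ) (x : ℝ) :
    Continuous (fun φ : (Fin 4 → ZMod n) → ℝ =>
      w g 0 φ * (((Y u φ : ℝ) : ℂ) ^ k * ((tiltProd u x φ : ℝ) : ℂ))) := by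
  unfold w Y S X tiltProd tiltQ D
  fun_prop

/-- the derivative integrands are continuous in the field. -/
theorem continuous_linTiltDerivIntegrand [NeZero n] (g : ℝ) (u : Fin 4 → ℝ) (k : ℕ) (x : ℝ) :
    Continuous (fun φ : (Fin 4 → ZMod n) → ℝ =>
      w g 0 φ * (((Y u φ : ℝ) : ℂ) ^ k *
        ((∑ y : Fin 4 → ZMod n, (∏ y' ∈ Finset.univ.erase y, (1 + x * tiltQ u (fun i => D φ i y')))
          * tiltQ u (fun i => D φ i y) : ℝ) : ℂ))) := by
  unfold w Y S X tiltQ D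
  fun_prop

/-- **Pointwise domination along the linear tilt:** for `|x| ≤ 1/(48(‖u‖+1))`,
`‖w_{g,0} Y_u^k P_x‖ ≤ (24k‖u‖+1)^k e^{−S_0/2}` and `‖w_{g,0} Y_u^k P_x'‖ ≤ 48‖u‖(24k‖u‖+1)^k e^{−S_0/2}`. -/
theorem norm_linTiltIntegrand_le [NeZero n] (g : ℝ) (u : Fin 4 → ℝ) (k : ℕ) {x : ℝ}
    (hx : |x| ≤ 1 / (48 * (‖u‖ + 1))) (φ : (Fin 4 → ZMod n) → ℝ) :
    ‖w g 0 φ * (((Y u φ : ℝ) : ℂ) ^ k * ((tiltProd u x φ : ℝ) : ℂ))‖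
        ≤ (24 * (k : ℝ) * ‖u‖ + 1) ^ k * Real.exp (-(S 0 φ) / 2) ∧
    ‖w g 0 φ * (((Y u φ : ℝ) : ℂ) ^ k *
        ((∑ y : Fin 4 → ZMod n, (∏ y' ∈ Finset.univ.erase y, (1 + x * tiltQ u (fun i => D φ i y')))
          * tiltQ u (fun i => D φ i y) : ℝ) : ℂ))‖
        ≤ 48 * ‖u‖ * (24 * (k : ℝ) * ‖u‖ + 1) ^ k * Real.exp (-(S 0 φ) / 2) := by
  have hS := S_zero_nonneg φ
  have hu0 : 0 ≤ ‖u‖ := norm_nonneg u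
  have hY := pow_abs_Y_le u φ k
  have hP := abs_tiltProd_le u φ hx
  have hP' := abs_tiltProd_deriv_le u φ hx
  have hS8 := le_eight_mul_exp_eighth (S 0 φ)
  have hC : 0 ≤ (24 * (k : ℝ) * ‖u‖ + 1) ^ k := by positivity
  have e1 : Real.exp (-(S 0 φ)) * Real.exp (S 0 φ / 4) * Real.exp (S 0 φ / 8) ≤ Real.exp (-(S 0 φ) / 2) := by
    rw [← Real.exp_add, ← Real.exp_add]
    exact Real.exp_le_exp.mpr (by linarith)
  have e2 : Real.exp (-(S 0 φ)) * Real.exp (S 0 φ / 4) * Real.exp (S 0 φ / 8) * Real.exp (S 0 φ / 8)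
      = Real.exp (-(S 0 φ) / 2) := by
    rw [← Real.exp_add, ← Real.exp_add, ← Real.exp_add]
    congr 1
    ring
  constructor
  · rw [norm_mul, norm_mul, norm_w_zero, norm_pow, Complex.norm_real, Real.norm_eq_abs, Complex.norm_real,
      Real.norm_eq_abs]
    calc Real.exp (-(S 0 φ)) * (|Y u φ| ^ k * |tiltProd u x φ|)
        ≤ Real.exp (-(S 0 φ)) * (((24 * (k : ℝ) * ‖u‖ + 1) ^ k * Real.exp (S 0 φ / 4)) * Real.exp (S 0 φ / 8)) := by
          gcongr
      _ = (24 * (k : ℝ) * ‖u‖ + 1) ^ k * (Real.exp (-(S 0 φ)) * Real.exp (S 0 φ / 4) * Real.exp (S 0 φ / 8)) := by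
          ring
      _ ≤ (24 * (k : ℝ) * ‖u‖ + 1) ^ k * Real.exp (-(S 0 φ) / 2) := mul_le_mul_of_nonneg_left e1 hC
  · rw [norm_mul, norm_mul, norm_w_zero, norm_pow, Complex.norm_real, Real.norm_eq_abs, Complex.norm_real,
      Real.norm_eq_abs]
    calc Real.exp (-(S 0 φ)) * (|Y u φ| ^ k *
          |∑ y : Fin 4 → ZMod n, (∏ y' ∈ Finset.univ.erase y, (1 + x * tiltQ u (fun i => D φ i y')))
            * tiltQ u (fun i => D φ i y)|)
        ≤ Real.exp (-(S 0 φ)) * (((24 * (k : ℝ) * ‖u‖ + 1) ^ k * Real.exp (S 0 φ / 4))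
            * (6 * ‖u‖ * S 0 φ * Real.exp (S 0 φ / 8))) := by gcongr
      _ ≤ Real.exp (-(S 0 φ)) * (((24 * (k : ℝ) * ‖u‖ + 1) ^ k * Real.exp (S 0 φ / 4))
            * (6 * ‖u‖ * (8 * Real.exp (S 0 φ / 8)) * Real.exp (S 0 φ / 8))) := by gcongr
      _ = 48 * ‖u‖ * (24 * (k : ℝ) * ‖u‖ + 1) ^ k *
            (Real.exp (-(S 0 φ)) * Real.exp (S 0 φ / 4) * Real.exp (S 0 φ / 8) * Real.exp (S 0 φ / 8)) := by ring
      _ = 48 * ‖u‖ * (24 * (k : ℝ) * ‖u‖ + 1) ^ k * Real.exp (-(S 0 φ) / 2) := by rw [e2]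

/-- **`(Mˡ_k)'(0) = M_{k+1}(0)`:** the linear-tilt moments are differentiable at `t = 0` under the integral
sign, with derivative the next exponential-tilt moment at `0` (`∫ w_{g,0} Y_u^{k+1}`). -/
theorem hasDerivAt_linTiltMoment_zero [NeZero n] (g : ℝ) (u : Fin 4 → ℝ) (k : ℕ) :
    HasDerivAt (linTiltMoment n g u k) (tiltMoment n g u (k + 1) 0) 0 := by
  set ε₀ : ℝ := 1 / (48 * (‖u‖ + 1)) with hε₀
  have hε₀pos : 0 < ε₀ := by positivity
  have hball : Metric.ball (0 : ℝ) ε₀ ∈ nhds (0 : ℝ) := Metric.ball_mem_nhds _ hε₀pos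
  have hmem : ∀ x ∈ Metric.ball (0 : ℝ) ε₀, |x| ≤ ε₀ := fun x hx => by
    have := Metric.mem_ball.mp hx
    rw [dist_zero_right, Real.norm_eq_abs] at this
    exact this.le
  have h00 : |(0 : ℝ)| ≤ ε₀ := by rw [abs_zero]; exact hε₀pos.le
  -- the parametrised integrand and its derivative
  set F : ℝ → ((Fin 4 → ZMod n) → ℝ) → ℂ := fun x φ =>
    w g 0 φ * (((Y u φ : ℝ) : ℂ) ^ k * ((tiltProd u x φ : ℝ) : ℂ)) with hF
  set F' : ℝ → ((Fin 4 → ZMod n) → ℝ) → ℂ := fun x φ =>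
    w g 0 φ * (((Y u φ : ℝ) : ℂ) ^ k *
      ((∑ y : Fin 4 → ZMod n, (∏ y' ∈ Finset.univ.erase y, (1 + x * tiltQ u (fun i => D φ i y')))
        * tiltQ u (fun i => D φ i y) : ℝ) : ℂ)) with hF'
  have hF_meas : ∀ x : ℝ, AEStronglyMeasurable (F x) volume := fun x =>
    (continuous_linTiltIntegrand g u k x).aestronglyMeasurable
  have hF_int : Integrable (F 0) :=
    ((integrable_exp_neg_half_S n).const_mul ((24 * (k : ℝ) * ‖u‖ + 1) ^ k)).mono' (hF_meas 0)
      (Filter.Eventually.of_forall (fun φ => (norm_linTiltIntegrand_le g u k h00 φ).1))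
  have hF'_meas : AEStronglyMeasurable (F' 0) volume :=
    (continuous_linTiltDerivIntegrand g u k 0).aestronglyMeasurable
  have hb_int : Integrable (fun φ : (Fin 4 → ZMod n) → ℝ =>
      48 * ‖u‖ * (24 * (k : ℝ) * ‖u‖ + 1) ^ k * Real.exp (-(S 0 φ) / 2)) :=
    (integrable_exp_neg_half_S n).const_mul _
  have h_bound : ∀ᵐ φ : (Fin 4 → ZMod n) → ℝ ∂volume, ∀ x ∈ Metric.ball (0 : ℝ) ε₀,
      ‖F' x φ‖ ≤ 48 * ‖u‖ * (24 * (k : ℝ) * ‖u‖ + 1) ^ k * Real.exp (-(S 0 φ) / 2) :=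
    Filter.Eventually.of_forall (fun φ x hx => (norm_linTiltIntegrand_le g u k (hmem x hx) φ).2)
  have h_diff : ∀ᵐ φ : (Fin 4 → ZMod n) → ℝ ∂volume, ∀ x ∈ Metric.ball (0 : ℝ) ε₀,
      HasDerivAt (fun s : ℝ => F s φ) (F' x φ) x := by
    refine Filter.Eventually.of_forall (fun φ x _ => ?_)
    have h1 := (hasDerivAt_tiltProd u φ x).ofReal_comp
    have h2 := (h1.const_mul (((Y u φ : ℝ) : ℂ) ^ k)).const_mul (w g 0 φ)
    simpa [hF, hF'] using h2
  have hmain := (hasDerivAt_integral_of_dominated_loc_of_deriv_le hball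
    (Filter.Eventually.of_forall hF_meas) hF_int hF'_meas h_bound hb_int h_diff).2
  have hval : (∫ φ : (Fin 4 → ZMod n) → ℝ, F' 0 φ) = tiltMoment n g u (k + 1) 0 := by
    unfold tiltMoment
    refine integral_congr_ae (Filter.Eventually.of_forall (fun φ => ?_))
    simp only [hF', zero_mul, add_zero, Finset.prod_const_one, one_mul, Complex.ofReal_zero,
      Complex.exp_zero, mul_one, pow_succ]
    rw [Y_eq_sum_tiltQ]
  rw [hval] at hmain
  exact hmain

/-- **The second cumulant as the `t`-derivative of a one-point function** (fixed volume): if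
`Z_n(g,0) ≠ 0`, then `t ↦ Mˡ₁(t)/Mˡ₀(t) = |Λ| · onePoint n 𝒦ˡ_{g,t} Q_u` has derivative
`⟨Y_u²⟩_g − ⟨Y_u⟩_g²` at `t = 0`. [cite: AdamsBuchholzKoteckyMuller2019, Thm 2.2] -/
theorem hasDerivAt_linTiltMean [NeZero n] (g : ℝ) (u : Fin 4 → ℝ) (hZ : Z n g 0 ≠ 0) :
    HasDerivAt (fun t : ℝ => linTiltMoment n g u 1 t / linTiltMoment n g u 0 t)
      (ev n g (fun φ => ((Y u φ ^ 2 : ℝ) : ℂ)) - (ev n g (fun φ => ((Y u φ : ℝ) : ℂ))) ^ 2) 0 := by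
  have hM0 := hasDerivAt_linTiltMoment_zero (n := n) g u 0
  have hM1 := hasDerivAt_linTiltMoment_zero (n := n) g u 1
  have hne : linTiltMoment n g u 0 0 ≠ 0 := by rwa [linTiltMoment_at_zero, tiltMoment_zero_zero]
  have h := hM1.div hM0 hne
  have e1 : ev n g (fun φ => ((Y u φ : ℝ) : ℂ)) = tiltMoment n g u 1 0 / Z n g 0 := by
    rw [← ev_pow_Y_eq]; simp
  have e2 : ev n g (fun φ => ((Y u φ ^ 2 : ℝ) : ℂ)) = tiltMoment n g u 2 0 / Z n g 0 := ev_pow_Y_eq g u 2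
  rw [e1, e2]
  refine h.congr_deriv ?_
  rw [linTiltMoment_at_zero, linTiltMoment_at_zero, tiltMoment_zero_zero]
  field_simp

/-- **Corollary (the shape consumed by the reduction to `OnePointLipschitz`):** if `Z_n(g,0) ≠ 0`, the map
`t ↦ |Λ| · onePoint n 𝒦ˡ_{g,t} Q_u` has derivative `⟨Y_u²⟩_g − ⟨Y_u⟩_g²` at `t = 0`. -/
theorem hasDerivAt_card_mul_onePoint_linTiltK [NeZero n] (g : ℝ) (u : Fin 4 → ℝ) (hZ : Z n g 0 ≠ 0) :
    HasDerivAt (fun t : ℝ =>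
        (Fintype.card (Fin 4 → ZMod n) : ℂ) * onePoint n (linTiltK g u t) (fun z => ((tiltQ u z : ℝ) : ℂ)))
      (ev n g (fun φ => ((Y u φ ^ 2 : ℝ) : ℂ)) - (ev n g (fun φ => ((Y u φ : ℝ) : ℂ))) ^ 2) 0 := by
  have h := hasDerivAt_linTiltMean g u hZ
  refine h.congr_of_eventuallyEq (Filter.Eventually.of_forall (fun t => ?_))
  exact onePoint_linTiltK g u t

end Summit.HubbardSuperconductivity.HubbardSuperconductivity.Theorems.ComplexGFF

end
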